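import Mathlib
import Summits.NavierStokesRegularity.NavierStokesRegularity.Theorems.TypeIQuarterGateScarEnvelopeTypeIZoomDictionaryDefs
import Summits.NavierStokesRegularity.NavierStokesRegularity.Theorems.TypeIQuarterGateScarEnvelopeTypeIFatKill
import Summits.NavierStokesRegularity.NavierStokesRegularity.Theorems.TypeIQuarterGateScarEnvelopeTypeIBudgetViolators
import Summits.NavierStokesRegularity.NavierStokesRegularity.Theorems.TypeIQuarterGateScarEnvelopeTypeIOfNoTwinScarObject
import Summits.NavierStokesRegularity.NavierStokesRegularity.Theorems.TypeIQuarterGateQuarterLawTypeIGlue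
import Summits.NavierStokesRegularity.NavierStokesRegularity.Theorems.TypeIQuarterGateEnvelopeQuarterLaw
import Summits.NavierStokesRegularity.NavierStokesRegularity.Theorems.TypeIQuarterGateScarEnvelopeTypeINearOneRateDss
import Literature.Analysis.FluidPDE.AncientAxisymmetricTypeILiouville
import Summits.NavierStokesRegularity.NavierStokesRegularity.Theorems.TypeIQuarterGateScarEnvelopeTypeISatelliteTowerDefs
import Summits.NavierStokesRegularity.NavierStokesRegularity.Theorems.TypeIQuarterGateScarEnvelopeTypeISatelliteTowerObjects
import Summits.NavierStokesRegularity.NavierStokesRegularity.Theorems.TypeIQuarterGateScarEnvelopeTypeISatelliteTowerClosure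
import Summits.NavierStokesRegularity.NavierStokesRegularity.Theorems.TypeIQuarterGateScarEnvelopeTypeISatelliteTowerEnvelopeStability
import Summits.NavierStokesRegularity.NavierStokesRegularity.Theorems.TypeIQuarterGateScarEnvelopeTypeISatelliteTowerRootRateDefs

/-!
# Part N1–N3: THE RATE LADDER — rate inheritance by tangent flows, transport to the next level, the tight rate and its monotonicity

Part N1–N3 of the ROUND-34 plate (v8): `rate_of_tangentU` (a local sup-norm rate at the zoom point is an a.e. rate of every tangent flow), `TowerObj.rate_transport`, `RootDescends.rateAt`/`Descends.rateAt`, the tight rate `tightRate` and `RootDescends.tightRate_le`, `rootRate_antitone`, `satelliteRate_antitone`.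

PROVENANCE: declaration texts VERBATIM from the HOME plates of the instrument seat nsreg-p3 (g24/g25, cell
`pub/ns-regularity-ideate`): `round-31/Tangent31prep.lean` v5 (sha16 `e5b8668e3a090216`; = ROUND-30 plate v10 + Part K) and,
for Part L, `round-32/Tangent32prep.lean` v6 (sha16 `6123f27718636121`); for Parts M/N, `round-34/Tangent34prep.lean`
v8 (sha16 `84f56c3bc8f4da24`; = v7 `922795f19cd5db01` + Part N);
the author cannot write under `Theorems/` (`perm.theorems-prover-only`); landed by the
LEAD-lineage prover ns-sz-p1 g5 on director-ns DIRECTOR-NS #218 (2), split into ≤ 400-line modules (the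
plate's `def`s gathered in `TypeIQuarterGateScarEnvelopeTypeIZoomDictionaryDefs`), namespace
`Summit.NavierStokesRegularity.NavierStokesRegularity.Cruxes.ScarEnvelopeTypeI.ZoomDictionary` (the plate's `NsregP3.R30P`), `E3` spelled out, one-line docstrings
added where the plate had none.  `--supports stmt-NavierStokesRegularity-23843 --as helper`.

HONEST FRAMING: dictionary / census TOOLING for the crux `TypeIQuarterGate.ScarEnvelopeTypeI` (item 23843):
equivalences and normal forms, kernel-checked; NO open statement is proved — 23843, its parent
`QuarterLawTypeI` (23726), the route and Navier–Stokes regularity are OPEN; hard core evaded: none.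
-/

-- the summit-side namespace repeats a component by design (single-conjunct summit, D-0017)
set_option linter.dupNamespace false

open MeasureTheory Set Metric Filter Topology
open scoped ENNReal

namespace Summit.NavierStokesRegularity.NavierStokesRegularity.Cruxes.ScarEnvelopeTypeI.ZoomDictionary

variable {u : ℝ → (EuclideanSpace ℝ (Fin 3)) → (EuclideanSpace ℝ (Fin 3))} {a : (EuclideanSpace ℝ (Fin 3))} {ν T : ℝ}

section Tower

open Literature.Analysis.FluidPDE
variable {U : ℝ → (EuclideanSpace ℝ (Fin 3)) → (EuclideanSpace ℝ (Fin 3))} {P : ℝ → (EuclideanSpace ℝ (Fin 3)) → ℝ} {y' : (EuclideanSpace ℝ (Fin 3))} {ν : ℝ}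
open Summit.NavierStokesRegularity.NavierStokesRegularity.Cruxes.ScarEnvelopeTypeI.ScarZoom
  (CruxHypotheses ScarViolators TwinScarObject singularAt_of_isBackwardSingularPoint
    exists_localEnergy_of_typeIBound) in

/-! #### N1. Rate inheritance: a local sup-rate at the zoom point is an a.e. rate of every tangent flow -/

/-- **RATE INHERITANCE (general frame).**  `u` continuous on `(T₀, T) × ℝ³`, the local rate
`√(T − t)‖u(t,x)‖ ≤ m` on `(T − δ², T) × B(a, δ)`, and a tangent flow `ū` at `(T, a)`: then
`√(−s)‖ū(s,y)‖ ≤ m` a.e. on `Q_R(0)` for every `R ∈ (0,1)`. -/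
theorem rate_of_tangentU {u : ℝ → (EuclideanSpace ℝ (Fin 3)) → (EuclideanSpace ℝ (Fin 3))} {p : ℝ → (EuclideanSpace ℝ (Fin 3)) → ℝ} {a : (EuclideanSpace ℝ (Fin 3))} {T₀ T : ℝ} (hT : T₀ < T)
    (hcont : ContinuousOn (Function.uncurry u) (Ioo T₀ T ×ˢ univ))
    {L : ℕ → ℝ} {ū : ℝ → (EuclideanSpace ℝ (Fin 3)) → (EuclideanSpace ℝ (Fin 3))} (hū : TangentU u p a T L ū) {m δ : ℝ} (hδ : 0 < δ)
    (hrate : ∀ t ∈ Ioo (T - δ ^ 2) T, ∀ x ∈ ball a δ, Real.sqrt (T - t) * ‖u t x‖ ≤ m)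
    {R : ℝ} (hR : R ∈ Ioo (0 : ℝ) 1) :
    ∀ᵐ z ∂(volume.restrict (parabolicCylinder R (0 : ℝ × (EuclideanSpace ℝ (Fin 3))))),
      Real.sqrt (-z.1) * ‖ū z.1 z.2‖ ≤ m := by
  obtain ⟨hLpos, hL0, pbar, hall⟩ := hū
  obtain ⟨-, hmem, hconv, -⟩ := hall R hR
  set Q : Set (ℝ × (EuclideanSpace ℝ (Fin 3))) := parabolicCylinder R (0 : ℝ × (EuclideanSpace ℝ (Fin 3))) with hQ
  have hQmeas : MeasurableSet Q := (isOpen_parabolicCylinder R (0 : ℝ × (EuclideanSpace ℝ (Fin 3)))).measurableSet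
  have hmemQ : ∀ z ∈ Q, -(R ^ 2) < z.1 ∧ z.1 < 0 ∧ ‖z.2‖ < R := fun z hz => by
    rw [hQ, mem_parabolicCylinder] at hz
    obtain ⟨⟨h1, h2⟩, h3⟩ := hz
    simp only [Prod.fst_zero, Prod.snd_zero, zero_sub, dist_zero_right] at h1 h2 h3
    exact ⟨h1, h2, h3⟩
  -- ## small scales
  have hδ₁ : 0 < min δ (Real.sqrt (T - T₀)) := lt_min hδ (Real.sqrt_pos.2 (by linarith))
  obtain ⟨k₀, hk₀⟩ : ∃ k₀ : ℕ, ∀ k ≥ k₀, L k < min δ (Real.sqrt (T - T₀)) :=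
    eventually_atTop.1 (hL0.eventually (gt_mem_nhds hδ₁))
  -- ## the zooms obey the rate exactly on `Q` once the scale is small
  have hzoomrate : ∀ k ≥ k₀, ∀ z ∈ Q,
      Real.sqrt (-z.1) * ‖zoom u a T (L k) z.1 z.2‖ ≤ m := fun k hk z hz => by
    obtain ⟨hz1, hz2, hz3⟩ := hmemQ z hz
    have hL := hLpos k
    have hLδ : L k < δ := (hk₀ k hk).trans_le (min_le_left _ _)
    have hneg : 0 < -z.1 := by linarith
    have hz1' : -z.1 < 1 := by nlinarith [hR.1, hR.2]
    have hL2 : L k ^ 2 < δ ^ 2 := pow_lt_pow_left₀ hLδ hL.le two_ne_zero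
    have ht : T + L k ^ 2 * z.1 ∈ Ioo (T - δ ^ 2) T := by
      refine ⟨?_, by nlinarith [mul_pos (pow_pos hL 2) hneg]⟩
      nlinarith [mul_lt_mul_of_pos_left hz1' (pow_pos hL 2)]
    have hx : a + L k • z.2 ∈ ball a δ := by
      rw [mem_ball, dist_eq_norm, add_sub_cancel_left, norm_smul, Real.norm_of_nonneg hL.le]
      calc L k * ‖z.2‖ ≤ L k * 1 := by
            refine mul_le_mul_of_nonneg_left ?_ hL.le
            linarith [hR.2]
        _ < δ := by linarith
    have h := hrate _ ht _ hx
    have hsq : Real.sqrt (T - (T + L k ^ 2 * z.1)) = L k * Real.sqrt (-z.1) := by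
      rw [show T - (T + L k ^ 2 * z.1) = L k ^ 2 * (-z.1) by ring, Real.sqrt_mul (sq_nonneg _),
        Real.sqrt_sq hL.le]
    rw [hsq] at h
    show Real.sqrt (-z.1) * ‖L k • u (T + L k ^ 2 * z.1) (a + L k • z.2)‖ ≤ m
    rw [norm_smul, Real.norm_of_nonneg hL.le]
    calc Real.sqrt (-z.1) * (L k * ‖u (T + L k ^ 2 * z.1) (a + L k • z.2)‖)
        = L k * Real.sqrt (-z.1) * ‖u (T + L k ^ 2 * z.1) (a + L k • z.2)‖ := by ring
      _ ≤ m := h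
  -- ## measurability of the small zooms on `Q` (continuity of `u` on the open strip)
  have hmeas : ∀ k ≥ k₀, AEStronglyMeasurable (Function.uncurry (zoom u a T (L k)))
      (volume.restrict Q) := fun k hk => by
    have hL := hLpos k
    have hLT : L k < Real.sqrt (T - T₀) := (hk₀ k hk).trans_le (min_le_right _ _)
    have hL2T : L k ^ 2 < T - T₀ := by
      calc L k ^ 2 < Real.sqrt (T - T₀) ^ 2 := pow_lt_pow_left₀ hLT hL.le two_ne_zero
        _ = T - T₀ := Real.sq_sqrt (by linarith)
    have hmap : ContinuousOn (fun z : ℝ × (EuclideanSpace ℝ (Fin 3)) => (T + L k ^ 2 * z.1, a + L k • z.2)) Q :=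
      (by fun_prop : Continuous fun z : ℝ × (EuclideanSpace ℝ (Fin 3)) => (T + L k ^ 2 * z.1, a + L k • z.2)).continuousOn
    have hmaps : MapsTo (fun z : ℝ × (EuclideanSpace ℝ (Fin 3)) => (T + L k ^ 2 * z.1, a + L k • z.2)) Q
        (Ioo T₀ T ×ˢ univ) := by
      intro z hz
      obtain ⟨hz1, hz2, -⟩ := hmemQ z hz
      have hneg : 0 < -z.1 := by linarith
      have hz1' : -z.1 < 1 := by nlinarith [hR.1, hR.2]
      refine ⟨⟨?_, by nlinarith [mul_pos (pow_pos hL 2) hneg]⟩, mem_univ _⟩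
      nlinarith [mul_lt_mul_of_pos_left hz1' (pow_pos hL 2)]
    have hcz : ContinuousOn (Function.uncurry (zoom u a T (L k))) Q :=
      ((hcont.comp hmap hmaps).const_smul (L k)).congr fun z _ => rfl
    exact hcz.aestronglyMeasurable hQmeas
  -- ## an a.e.-convergent subsequence of the shifted zooms
  have hconv' : Tendsto (fun k => eLpNorm (Function.uncurry (zoom u a T (L (k + k₀))) -
      Function.uncurry ū) 3 (volume.restrict Q)) atTop (𝓝 0) :=
    hconv.comp (tendsto_add_atTop_nat k₀)
  obtain ⟨ns, -, hae⟩ := exists_subseq_tendsto_ae₃ (v := fun k => zoom u a T (L (k + k₀)))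
    (fun k => hmeas (k + k₀) (Nat.le_add_left _ _)) hmem.aestronglyMeasurable hconv'
  filter_upwards [hae, ae_restrict_mem hQmeas] with z hz hzQ
  have hlim : Tendsto (fun i => Real.sqrt (-z.1) *
      ‖Function.uncurry (zoom u a T (L (ns i + k₀))) z‖) atTop
      (𝓝 (Real.sqrt (-z.1) * ‖Function.uncurry ū z‖)) :=
    hz.norm.const_mul _
  exact le_of_tendsto' hlim fun i => hzoomrate (ns i + k₀) (Nat.le_add_left _ _) z hzQ

/-- **RATE INHERITANCE (tower frame).**  For a tower object `U` (continuous on the open past), a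
local rate `√(−t)‖U(t,x)‖ ≤ m` on `(−δ², 0) × B(y', δ)` and a tangent flow `Ū` at `(0, y')`:
`√(−s)‖Ū(s,y)‖ ≤ m` a.e. on every `Q_R(0)`, `R < 1`. -/
theorem TowerObj.rate_tangentU {M : ℝ} (h : TowerObj M U P) {y' : (EuclideanSpace ℝ (Fin 3))} {L : ℕ → ℝ}
    {Ū : ℝ → (EuclideanSpace ℝ (Fin 3)) → (EuclideanSpace ℝ (Fin 3))} (hŪ : TangentU U P y' 0 L Ū) {m δ : ℝ} (hδ : 0 < δ)
    (hrate : ∀ t ∈ Ioo (-(δ ^ 2)) 0, ∀ x ∈ ball y' δ, Real.sqrt (-t) * ‖U t x‖ ≤ m)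
    {R : ℝ} (hR : R ∈ Ioo (0 : ℝ) 1) :
    ∀ᵐ z ∂(volume.restrict (parabolicCylinder R (0 : ℝ × (EuclideanSpace ℝ (Fin 3))))),
      Real.sqrt (-z.1) * ‖Ū z.1 z.2‖ ≤ m := by
  have hc : ContinuousOn (Function.uncurry U) (Ioo (-1) 0 ×ˢ univ) :=
    h.2.1.mono (prod_mono Ioo_subset_Iio_self Subset.rfl)
  refine rate_of_tangentU (by norm_num) hc hŪ hδ (fun t ht x hx => ?_) hR
  rw [zero_sub]
  exact hrate t (by simpa using ht) x hx

/-! #### N2. The local rate at a final-time point; transport to the next level EVERYWHERE -/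

/-- A local sup-norm rate is monotone in the constant. [folklore] -/
theorem RateAt.mono {m m' : ℝ} {U : ℝ → (EuclideanSpace ℝ (Fin 3)) → (EuclideanSpace ℝ (Fin 3))} {y' : (EuclideanSpace ℝ (Fin 3))} (h : RateAt m U y') (hm : m ≤ m') :
    RateAt m' U y' := by
  obtain ⟨δ, hδ, hr⟩ := h
  exact ⟨δ, hδ, fun t ht x hx => (hr t ht x hx).trans hm⟩

/-- A local sup-norm rate constant is nonnegative. [folklore] -/
theorem RateAt.nonneg {m : ℝ} {U : ℝ → (EuclideanSpace ℝ (Fin 3)) → (EuclideanSpace ℝ (Fin 3))} {y' : (EuclideanSpace ℝ (Fin 3))} (h : RateAt m U y') : 0 ≤ m := by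
  obtain ⟨δ, hδ, hr⟩ := h
  have ht : -(δ ^ 2) / 2 ∈ Ioo (-(δ ^ 2)) 0 := by
    constructor <;> nlinarith [pow_pos hδ 2]
  exact (mul_nonneg (Real.sqrt_nonneg _) (norm_nonneg _)).trans
    (hr _ ht y' (mem_ball_self hδ))

/-- The global rate `M` of the class is a local rate at every point. -/
theorem rateAt_of_hasTypeITimeDecay {M : ℝ} {U : ℝ → (EuclideanSpace ℝ (Fin 3)) → (EuclideanSpace ℝ (Fin 3))} (hdec : HasTypeITimeDecay M U)
    (y' : (EuclideanSpace ℝ (Fin 3))) : RateAt M U y' := by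
  refine ⟨1, one_pos, fun t ht x _ => ?_⟩
  have hs : 0 < Real.sqrt (-t) := Real.sqrt_pos.2 (by linarith [ht.2])
  have h := hdec t ht.2 x
  rwa [le_div_iff₀ hs, mul_comm] at h

/-- A tower object of rate `M` has local rate `M` at every final-time point. [folklore] -/
theorem TowerObj.rateAt {M : ℝ} (h : TowerObj M U P) (y' : (EuclideanSpace ℝ (Fin 3))) : RateAt M U y' :=
  rateAt_of_hasTypeITimeDecay h.2.2.1 y'

/-- From an a.e. rate on `Q_R(0)` to the rate EVERYWHERE on `Q_R(0)` for a field continuous on the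
open past (L0). -/
theorem rate_everywhere_of_ae {U' : ℝ → (EuclideanSpace ℝ (Fin 3)) → (EuclideanSpace ℝ (Fin 3))} (hc : ContinuousOn (Function.uncurry U') (Iio 0 ×ˢ univ))
    {m R : ℝ} (h : ∀ᵐ z ∂(volume.restrict (parabolicCylinder R (0 : ℝ × (EuclideanSpace ℝ (Fin 3))))),
      Real.sqrt (-z.1) * ‖U' z.1 z.2‖ ≤ m) :
    ∀ t ∈ Ioo (-(R ^ 2)) 0, ∀ x ∈ ball (0 : (EuclideanSpace ℝ (Fin 3))) R, Real.sqrt (-t) * ‖U' t x‖ ≤ m := by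
  intro t ht x hx
  have hO : IsOpen (parabolicCylinder R (0 : ℝ × (EuclideanSpace ℝ (Fin 3)))) := isOpen_parabolicCylinder R _
  have hsub : parabolicCylinder R (0 : ℝ × (EuclideanSpace ℝ (Fin 3))) ⊆ Iio (0 : ℝ) ×ˢ (univ : Set (EuclideanSpace ℝ (Fin 3))) :=
    parabolicCylinder_subset_lowerHalf R (0 : (EuclideanSpace ℝ (Fin 3)))
  have hf : ContinuousOn (Function.uncurry U') (parabolicCylinder R (0 : ℝ × (EuclideanSpace ℝ (Fin 3)))) := hc.mono hsub
  have hg : ContinuousOn (fun z : ℝ × (EuclideanSpace ℝ (Fin 3)) => m / Real.sqrt (-z.1)) (parabolicCylinder R (0 : ℝ × (EuclideanSpace ℝ (Fin 3)))) := by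
    refine ContinuousOn.div continuousOn_const continuous_fst.neg.sqrt.continuousOn ?_
    intro z hz
    have hz0 : z.1 < 0 := by simpa using ((mem_parabolicCylinder).1 hz).1.2
    exact (Real.sqrt_pos.2 (neg_pos.2 hz0)).ne'
  have h' : ∀ᵐ z ∂(volume.restrict (parabolicCylinder R (0 : ℝ × (EuclideanSpace ℝ (Fin 3))))),
      ‖Function.uncurry U' z‖ ≤ m / Real.sqrt (-z.1) := by
    filter_upwards [h, ae_restrict_mem hO.measurableSet] with z hz hzmem
    have hz0 : z.1 < 0 := by simpa using ((mem_parabolicCylinder).1 hzmem).1.2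
    have hs : 0 < Real.sqrt (-z.1) := Real.sqrt_pos.2 (neg_pos.2 hz0)
    rw [le_div_iff₀ hs, mul_comm]
    exact hz
  have hmem : ((t, x) : ℝ × (EuclideanSpace ℝ (Fin 3))) ∈ parabolicCylinder R (0 : ℝ × (EuclideanSpace ℝ (Fin 3))) := by
    rw [mem_parabolicCylinder]
    simp only [Prod.fst_zero, Prod.snd_zero, zero_sub, dist_zero_right]
    exact ⟨ht, mem_ball_zero_iff.1 hx⟩
  have hs : 0 < Real.sqrt (-t) := Real.sqrt_pos.2 (neg_pos.2 ht.2)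
  have h1 := norm_le_of_ae_le_of_continuousOn hO hf hg h' (t, x) hmem
  have h2 : ‖U' t x‖ ≤ m / Real.sqrt (-t) := by simpa using h1
  rwa [le_div_iff₀ hs, mul_comm] at h2

/-- **RATE TRANSPORT.**  For tower objects `U`, `U'`, a tangent flow `Ū` of `U` at `(0, y')`
identified a.e. with `U'` on every `Q_R(0)`, `R < 1`, and a local rate `m` of `U` at `y'`:
`√(−t)‖U'(t,x)‖ ≤ m` on ALL of `Q_R(0)` for every `R < 1`. -/
theorem TowerObj.rate_transport {M M' : ℝ} (h : TowerObj M U P) {U' : ℝ → (EuclideanSpace ℝ (Fin 3)) → (EuclideanSpace ℝ (Fin 3))} {P' : ℝ → (EuclideanSpace ℝ (Fin 3)) → ℝ}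
    (h' : TowerObj M' U' P') {y' : (EuclideanSpace ℝ (Fin 3))} {L : ℕ → ℝ} {Ū : ℝ → (EuclideanSpace ℝ (Fin 3)) → (EuclideanSpace ℝ (Fin 3))} (hŪ : TangentU U P y' 0 L Ū)
    (hae : ∀ R ∈ Ioo (0 : ℝ) 1, ∀ᵐ z ∂(volume.restrict (parabolicCylinder R (0 : ℝ × (EuclideanSpace ℝ (Fin 3))))),
      Ū z.1 z.2 = U' z.1 z.2)
    {m : ℝ} (hm : RateAt m U y') {R : ℝ} (hR : R ∈ Ioo (0 : ℝ) 1) :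
    ∀ t ∈ Ioo (-(R ^ 2)) 0, ∀ x ∈ ball (0 : (EuclideanSpace ℝ (Fin 3))) R, Real.sqrt (-t) * ‖U' t x‖ ≤ m := by
  obtain ⟨δ, hδ, hr⟩ := hm
  refine rate_everywhere_of_ae h'.2.1 ?_
  filter_upwards [h.rate_tangentU hŪ hδ hr hR, hae R hR] with z hz hzz
  rw [← hzz]
  exact hz

/-- **RATE TRANSPORT, local form**: the rate `m` at the zoom point becomes a local rate of the next
level at EVERY point of the open unit ball. -/
theorem TowerObj.rateAt_transport {M M' : ℝ} (h : TowerObj M U P) {U' : ℝ → (EuclideanSpace ℝ (Fin 3)) → (EuclideanSpace ℝ (Fin 3))} {P' : ℝ → (EuclideanSpace ℝ (Fin 3)) → ℝ}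
    (h' : TowerObj M' U' P') {y' : (EuclideanSpace ℝ (Fin 3))} {L : ℕ → ℝ} {Ū : ℝ → (EuclideanSpace ℝ (Fin 3)) → (EuclideanSpace ℝ (Fin 3))} (hŪ : TangentU U P y' 0 L Ū)
    (hae : ∀ R ∈ Ioo (0 : ℝ) 1, ∀ᵐ z ∂(volume.restrict (parabolicCylinder R (0 : ℝ × (EuclideanSpace ℝ (Fin 3))))),
      Ū z.1 z.2 = U' z.1 z.2)
    {m : ℝ} (hm : RateAt m U y') {y : (EuclideanSpace ℝ (Fin 3))} (hy : ‖y‖ < 1) : RateAt m U' y := by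
  set R : ℝ := (1 + ‖y‖) / 2 with hRdef
  have hR : R ∈ Ioo (0 : ℝ) 1 := ⟨by positivity, by rw [hRdef]; linarith⟩
  have hall := h.rate_transport h' hŪ hae hm hR
  set δ : ℝ := (1 - ‖y‖) / 2 with hδdef
  have hδ : 0 < δ := by rw [hδdef]; linarith
  have hδR : δ ≤ R := by rw [hδdef, hRdef]; linarith [norm_nonneg y]
  refine ⟨δ, hδ, fun t ht x hx => hall t ⟨?_, ht.2⟩ x ?_⟩
  · have : δ ^ 2 ≤ R ^ 2 := pow_le_pow_left₀ hδ.le hδR 2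
    linarith [ht.1]
  · rw [mem_ball_zero_iff]
    calc ‖x‖ = ‖(x - y) + y‖ := by rw [sub_add_cancel]
      _ ≤ ‖x - y‖ + ‖y‖ := norm_add_le _ _
      _ < δ + ‖y‖ := by
          have hxy : ‖x - y‖ < δ := by rwa [mem_ball, dist_eq_norm] at hx
          linarith
      _ = R := by rw [hδdef, hRdef]; ring

/-- **Along a ROOT DESCENT the root rate is transported to the whole unit ball of the next level.** -/
theorem RootDescends.rateAt {M : ℝ} {n n' : TNode} (hn : ABTower M n.U n.P n.H)
    (hn' : ABTower M n'.U n'.P n'.H) (hd : RootDescends n n') {m : ℝ} (hm : RateAt m n.U 0)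
    {y : (EuclideanSpace ℝ (Fin 3))} (hy : ‖y‖ < 1) : RateAt m n'.U y := by
  obtain ⟨L, Ū, hŪ, hae, -, -⟩ := hd
  exact (towerObj_of_abTower hn).rateAt_transport (towerObj_of_abTower hn') hŪ hae hm hy

/-- **Along a SATELLITE DESCENT the rate at the satellite is transported to the whole unit ball of
the next level.** -/
theorem Descends.rateAt {M : ℝ} {n n' : TNode} (hn : ABTower M n.U n.P n.H)
    (hn' : ABTower M n'.U n'.P n'.H) (hd : Descends n n') {m : ℝ} (hm : RateAt m n.U n.y)
    {y : (EuclideanSpace ℝ (Fin 3))} (hy : ‖y‖ < 1) : RateAt m n'.U y := by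
  obtain ⟨L, Ū, hŪ, hae, -⟩ := hd
  exact (towerObj_of_abTower hn).rateAt_transport (towerObj_of_abTower hn') hŪ hae hm hy

/-! #### N3. The TIGHT RATE and its monotonicity along the census -/

/-- The set of admissible local rates at a point is bounded below (by `0`). [folklore] -/
theorem bddBelow_rateAt (U : ℝ → (EuclideanSpace ℝ (Fin 3)) → (EuclideanSpace ℝ (Fin 3))) (y' : (EuclideanSpace ℝ (Fin 3))) : BddBelow {m : ℝ | RateAt m U y'} :=
  ⟨0, fun _ hm => RateAt.nonneg hm⟩

/-- The tight rate is below every admissible rate. [folklore] -/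
theorem tightRate_le_of_rateAt {m : ℝ} {U : ℝ → (EuclideanSpace ℝ (Fin 3)) → (EuclideanSpace ℝ (Fin 3))} {y' : (EuclideanSpace ℝ (Fin 3))} (h : RateAt m U y') :
    tightRate U y' ≤ m :=
  csInf_le (bddBelow_rateAt U y') h

/-- The tight rate of a tower object is nonnegative. [folklore] -/
theorem tightRate_nonneg {M : ℝ} (h : TowerObj M U P) (y' : (EuclideanSpace ℝ (Fin 3))) : 0 ≤ tightRate U y' :=
  le_csInf ⟨M, h.rateAt y'⟩ fun _ hm => RateAt.nonneg hm

/-- The tight rate of a tower object of rate `M` is at most `M`. [folklore] -/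
theorem TowerObj.tightRate_le {M : ℝ} (h : TowerObj M U P) (y' : (EuclideanSpace ℝ (Fin 3))) : tightRate U y' ≤ M :=
  tightRate_le_of_rateAt (h.rateAt y')

/-- Every constant above the tight rate is a local rate. -/
theorem TowerObj.rateAt_of_tightRate_lt {M : ℝ} (h : TowerObj M U P) {y' : (EuclideanSpace ℝ (Fin 3))} {m : ℝ}
    (hm : tightRate U y' < m) : RateAt m U y' := by
  obtain ⟨m', hm', hlt⟩ := (csInf_lt_iff (bddBelow_rateAt U y') ⟨M, h.rateAt y'⟩).1 hm
  exact RateAt.mono hm' hlt.le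

/-- **MONOTONICITY ALONG A ROOT DESCENT**: the tight rate at EVERY point of the open unit ball of the
next level is at most the tight rate at the root of the previous level. -/
theorem RootDescends.tightRate_le {M : ℝ} {n n' : TNode} (hn : ABTower M n.U n.P n.H)
    (hn' : ABTower M n'.U n'.P n'.H) (hd : RootDescends n n') {y : (EuclideanSpace ℝ (Fin 3))} (hy : ‖y‖ < 1) :
    tightRate n'.U y ≤ tightRate n.U 0 :=
  le_of_forall_gt_imp_ge_of_dense fun _ hm =>
    tightRate_le_of_rateAt (hd.rateAt hn hn' ((towerObj_of_abTower hn).rateAt_of_tightRate_lt hm) hy)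

/-- **MONOTONICITY ALONG A SATELLITE DESCENT.** -/
theorem Descends.tightRate_le {M : ℝ} {n n' : TNode} (hn : ABTower M n.U n.P n.H)
    (hn' : ABTower M n'.U n'.P n'.H) (hd : Descends n n') {y : (EuclideanSpace ℝ (Fin 3))} (hy : ‖y‖ < 1) :
    tightRate n'.U y ≤ tightRate n.U n.y :=
  le_of_forall_gt_imp_ge_of_dense fun _ hm =>
    tightRate_le_of_rateAt (hd.rateAt hn hn' ((towerObj_of_abTower hn).rateAt_of_tightRate_lt hm) hy)

/-- ★ **THE RATE LADDER (root descent).**  Along an infinite root descent the tight ROOT rate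
`k ↦ tightRate (c k).U 0` is NON-INCREASING, lies in `[0, M]`, and converges. -/
theorem rootRate_antitone {M : ℝ} {c : ℕ → TNode}
    (hc : ∀ k, RootObj M (c k) ∧ ¬ TameRoot (c k) ∧ RootDescends (c k) (c (k + 1))) :
    Antitone (fun k => tightRate (c k).U 0) :=
  antitone_nat_of_succ_le fun k =>
    (hc k).2.2.tightRate_le (hc k).1.1 (hc (k + 1)).1.1 (by simp)

/-- Along a root descent of rate `M` every root rate lies in `[0, M]`. [folklore] -/
theorem rootRate_mem_Icc {M : ℝ} {c : ℕ → TNode}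
    (hc : ∀ k, RootObj M (c k) ∧ ¬ TameRoot (c k) ∧ RootDescends (c k) (c (k + 1))) (k : ℕ) :
    tightRate (c k).U 0 ∈ Icc 0 M :=
  ⟨tightRate_nonneg (towerObj_of_abTower (hc k).1.1) 0,
    (towerObj_of_abTower (hc k).1.1).tightRate_le 0⟩

/-- Along a root descent the (antitone, bounded) root rates converge to some `m ∈ [0, M]` below all of them. [folklore] -/
theorem rootRate_tendsto {M : ℝ} {c : ℕ → TNode}
    (hc : ∀ k, RootObj M (c k) ∧ ¬ TameRoot (c k) ∧ RootDescends (c k) (c (k + 1))) :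
    ∃ m : ℝ, m ∈ Icc 0 M ∧ (∀ k, m ≤ tightRate (c k).U 0) ∧
      Tendsto (fun k => tightRate (c k).U 0) atTop (𝓝 m) := by
  have hbdd : BddBelow (range fun k => tightRate (c k).U 0) :=
    ⟨0, by rintro _ ⟨k, rfl⟩; exact (rootRate_mem_Icc hc k).1⟩
  refine ⟨⨅ k, tightRate (c k).U 0, ⟨le_ciInf fun k => (rootRate_mem_Icc hc k).1,
    (ciInf_le hbdd 0).trans (rootRate_mem_Icc hc 0).2⟩, fun k => ciInf_le hbdd k,
    tendsto_atTop_ciInf (rootRate_antitone hc) hbdd⟩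

/-- ★ **THE RATE LADDER (satellite descent).**  Along an infinite satellite descent the tight rate AT
THE CHOSEN SATELLITE `k ↦ tightRate (c k).U (c k).y` is NON-INCREASING. -/
theorem satelliteRate_antitone {M : ℝ} {c : ℕ → TNode}
    (hc : ∀ k, RootedNode M (c k) ∧ ¬ TameNode (c k) ∧ Descends (c k) (c (k + 1))) :
    Antitone (fun k => tightRate (c k).U (c k).y) :=
  antitone_nat_of_succ_le fun k => by
    obtain ⟨-, -, -, -, hy1⟩ := (hc k).2.2
    exact (hc k).2.2.tightRate_le (hc k).1.1.1 (hc (k + 1)).1.1.1 hy1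

/-! #### N4. The printed FLOOR (hypothesis-shaped) and the η-SATURATED normal form of the far levels -/

/-- **THE FLOOR**: under the printed small-rate regularity, the tight rate at a SINGULAR final-time
point is at least `ε`. -/
theorem TowerObj.le_tightRate_of_not_regPt {M ε : ℝ} (hWZ : SmallRateRegularity M ε)
    (h : TowerObj M U P) {y' : (EuclideanSpace ℝ (Fin 3))} (hy : ¬ RegPt U y') : ε ≤ tightRate U y' := by
  by_contra hlt
  exact hy (hWZ U P h y' (h.rateAt_of_tightRate_lt (lt_of_not_ge hlt)))

/-- ★ **THE RATE TRAP.**  Under the printed floor, along an infinite root descent the tight root rates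
form a non-increasing sequence in `[ε, M]` converging to some `m_∞ ∈ [ε, M]`; in particular `ε ≤ M`
(a class with `M < ε` has no infinite root descent — and indeed no singular object at all). -/
theorem rootRate_trap {M ε : ℝ} (hWZ : SmallRateRegularity M ε) {c : ℕ → TNode}
    (hc : ∀ k, RootObj M (c k) ∧ ¬ TameRoot (c k) ∧ RootDescends (c k) (c (k + 1))) :
    ∃ m : ℝ, m ∈ Icc ε M ∧ Antitone (fun k => tightRate (c k).U 0) ∧
      (∀ k, tightRate (c k).U 0 ∈ Icc m M) ∧
      Tendsto (fun k => tightRate (c k).U 0) atTop (𝓝 m) := by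
  obtain ⟨m, hm, hle, ht⟩ := rootRate_tendsto hc
  have hε : ∀ k, ε ≤ tightRate (c k).U 0 := fun k =>
    (towerObj_of_abTower (hc k).1.1).le_tightRate_of_not_regPt hWZ (hc k).1.2
  refine ⟨m, ⟨ge_of_tendsto' ht hε, hm.2⟩, rootRate_antitone hc,
    fun k => ⟨hle k, (rootRate_mem_Icc hc k).2⟩, ht⟩

end Tower

end Summit.NavierStokesRegularity.NavierStokesRegularity.Cruxes.ScarEnvelopeTypeI.ZoomDictionary
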